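import Literature.NumberTheory.Automorphic.UnitaryGroupCotangentSpectralProjection
import Literature.NumberTheory.Automorphic.DiscreteSummandProjectionIntegral
import Literature.Geometry.ComplexHyperbolic.UnitBallU21Borel
import HarnessLib

/-!
# Crux `H413`, (D) desk sub-line `F0_P2SpectralProjectionD` — stub **(H)** `stub_H_projectedL2Data`: the spectral projection `pr_P`
# TRANSPORTS the `L²`-level cotangent data (A-pool hand A-p06 (g18); served item `stmt-HodgeConjecture-24833`, `--as helper`)

HC_CM is proved only modulo the 7 printed citations until rung 0 closes.

The registered desk sub-line `Cruxes/H413/Lines/F0_P2SpectralProjectionD.lean` (v1.1, sha16 e1fa5bd1360092b6, F0P2-plan (g2)) cuts the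
(D) socket `CotangentForms.holCotFormSpectralProjection` into six stubs K ∕ S ∕ H ∕ R ∕ G ∕ T.  Stub (H) says: for every discrete
automorphic `P` of `U(H)(𝔸_{L⁺})` and every pair `u = (u₀, u₁)` of `L²` classes carrying the `L²`-LEVEL COTANGENT DATA `IsL2CotPair ν A u`
— reproduction `T_A u = u` by the matrix kernel `A` on `U(2,1)` (`kernelOp`), right `K_c`-invariance, right invariance under an open
`K_f ≤ U(H)(𝔸_{L⁺,f})`, the cotangent `K_∞`-type relation along `cmArchSection ∘ Stab(x₀)`, differentiability at `0` of the `𝔭`-orbit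
maps `b ↦ R(cmArchSection (exp X_b)) u_j` and weak (`L²`) Cauchy–Riemann — the projected pair `j ↦ pr_P u_j` carries the same data.

WHY ([BorelJacquet1979, §4.6]; [Bump1997, proof of Thm. 3.6.1, p. 342]): `pr_P = P.space.toSubmodule.starProjection` is a continuous
`ℂ`-linear map commuting with every `R(g)` (★ `DiscreteAutomorphicRep.starProjection_rightRegular`).  Hence it commutes with the Bochner
integrals `∫ A(t)_{ji} • R(ιinf t) · dν(t)` (★ `starProjection_integral_smul_rightRegular`, p796771) — and, since the REGISTERED type of
(H) carries no regularity clause on `A`, we prove the commutation UNCONDITIONALLY (`starProjection_integral_smul_rightRegular'`, §1):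
when the scalar weight `t ↦ A(t)_{ji}` is not integrable, both integrals are Mathlib's junk value `0` (for `v ≠ 0` the weighted orbit map
`t ↦ a t • R(c t) v` is integrable iff `a` is, `integrable_iff_integrable_smul_rightRegular`, because `a t = ⟪R(c t) v, a t • R(c t) v⟫ ∕ ‖v‖²`
and `‖a t • R(c t) v‖ = |a t|·‖v‖` by unitarity).  Invariances and the finite `K`-type relation pass through `pr_P` (★
`rightRegular_starProjection_eq_sum`), and the `𝔭`-orbit map of `pr_P v` is `pr_P ∘ (orbit map of v)`, so it is differentiable with
differential `pr_P ∘ D` (chain rule, `ContinuousLinearMap.hasFDerivAt`), `ℂ`-linear together with `D` [DeitmarEchterhoff2014, Thm. 7.3.2].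

THE CLOSER `stubHProjectedL2Data_holds` has as TYPE the body of the line's `def StubHProjectedL2Data : Prop` with the Lines-local bundles
UNFOLDED (s347; nothing imports a `Lines` module, s380 (b)): `G3 L H` ↦ `adelicGroupData L⁺ L c̄ 3 H`, `orbitP`∕`kernelOp`∕`IsWeaklyHol` ↦
their bodies, and the Lines-local `structure IsL2CotPair … u : Prop` (6 fields `repro kc kf ktype diffOrbit weakHol`) ↦ its six fields IN
ORDER, as six hypotheses (for `u`) and a six-fold conjunction (for `pr_P ∘ u`).  The line's edition therefore reads
`theorem stub_H_projectedL2Data : StubHProjectedL2Data := fun L _ _ _ ι H T hT μ _ ν _ A P u hu =>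
  let h := F0P2dStubHProjectedL2Data.stubHProjectedL2Data_holds L ι H T hT μ ν A P u hu.repro hu.kc hu.kf hu.ktype hu.diffOrbit hu.weakHol;
  ⟨h.1, h.2.1, h.2.2.1, h.2.2.2.1, h.2.2.2.2.1, h.2.2.2.2.2⟩`.

No definition, no named fact, no `sorry`; imports ★ `UnitaryGroupCotangentSpectralProjection` (carriers `cmArchSection`, `cmCompactFactor`,
`DiscreteAutomorphicRep`), ★ `DiscreteSummandProjectionIntegral` (p796771) and ★ `UnitBallU21Borel` (Borel structure of `U(2,1)`).

## References
* [BorelJacquet1979] A. Borel, H. Jacquet, *Automorphic forms and automorphic representations*, PSPM 33.1 (1979), §4.6.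
* [Bump1997] D. Bump, *Automorphic forms and representations* (1997), proof of Thm. 3.6.1, p. 342.
* [DeitmarEchterhoff2014] A. Deitmar, S. Echterhoff, *Principles of Harmonic Analysis*, 2nd ed. (2014), Thm. 7.3.2.
-/

-- the mandated namespace repeats `HodgeConjecture.HodgeConjecture`, as in every `Theorems/*.lean` of this sub-problem
set_option linter.dupNamespace false

noncomputable section

open MeasureTheory NumberField MulAction
open scoped InnerProductSpace Matrix ComplexOrder

namespace Summit.HodgeConjecture.HodgeConjecture.Cruxes.H413.F0P2dStubHProjectedL2Data

open Literature.NumberTheory.Automorphic Literature.NumberTheory.Automorphic.UnitaryGroup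
open Literature.NumberTheory.Automorphic.UnitaryGroup.CotangentForms
open Literature.AlgebraicGeometry.ShimuraVarieties
open Literature.Geometry.ComplexHyperbolic.BallModel (U21 x₀)

/-! ## §1 Generic part: `pr_P` and Bochner-integrated operators `∫ a(t) • R(c t) · dρ`, WITHOUT integrability hypotheses -/

section Generic

universe u

variable {K : Type} [Field K] [NumberField K] {𝒢 : AdelicGroupData.{u} K} {μ : Measure 𝒢.automorphicQuotient}
  [𝒢.IsAutomorphicMeasure μ]

/-- `R(g)` preserves `⟪v, v⟫` (it is norm preserving, ★ `norm_rightRegular_apply`). [cite: BorelJacquet1979, §4.6] -/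
theorem inner_rightRegular_self (g : 𝒢.Adelic) (v : 𝒢.L2 μ) :
    ⟪𝒢.rightRegular μ g v, 𝒢.rightRegular μ g v⟫_ℂ = ⟪v, v⟫_ℂ := by
  rw [inner_self_eq_norm_sq_to_K, inner_self_eq_norm_sq_to_K, 𝒢.norm_rightRegular_apply μ g v]

/-- For `v ≠ 0`, the scalar weight `a` is recovered from the weighted orbit map:
`a t = ⟪R(c t) v, a t • R(c t) v⟫ · ⟪v, v⟫⁻¹`. [cite: BorelJacquet1979, §4.6] -/
theorem eq_inner_rightRegular_smul_mul_inv {T : Type*} {c : T → 𝒢.Adelic} {a : T → ℂ} {v : 𝒢.L2 μ} (hv : v ≠ 0) (t : T) :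
    a t = ⟪𝒢.rightRegular μ (c t) v, a t • 𝒢.rightRegular μ (c t) v⟫_ℂ * (⟪v, v⟫_ℂ)⁻¹ := by
  rw [inner_smul_right, inner_rightRegular_self, mul_inv_cancel_right₀ (inner_self_ne_zero.mpr hv)]

/-- **Integrability transfer.** For `v ≠ 0` and `c` continuous: if the weighted orbit map `t ↦ a t • R(c t) v` is Bochner integrable, so is
the scalar weight `a` (measurability from `a t = ⟪R(c t) v, a t • R(c t) v⟫ · ⟪v, v⟫⁻¹`, strong continuity of `R` ★
`isStronglyContinuous_rightRegular_holds`; finiteness from `‖a t • R(c t) v‖ = |a t|·‖v‖`). [cite: BorelJacquet1979, §4.6] -/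
theorem integrable_of_integrable_smul_rightRegular {T : Type*} [TopologicalSpace T] [MeasurableSpace T] [OpensMeasurableSpace T]
    [SecondCountableTopology T] (ρ : Measure T) {c : T → 𝒢.Adelic} (hc : Continuous c) {a : T → ℂ} {v : 𝒢.L2 μ} (hv : v ≠ 0)
    (h : Integrable (fun t => a t • 𝒢.rightRegular μ (c t) v) ρ) : Integrable a ρ := by
  have hcont : Continuous fun t => 𝒢.rightRegular μ (c t) v :=
    (𝒢.isStronglyContinuous_rightRegular_holds μ v).comp hc
  have hnv : (‖v‖ : ℝ) ≠ 0 := norm_ne_zero_iff.mpr hv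
  have hmeas : AEStronglyMeasurable a ρ := by
    have hm : AEStronglyMeasurable
        (fun t => ⟪𝒢.rightRegular μ (c t) v, a t • 𝒢.rightRegular μ (c t) v⟫_ℂ * (⟪v, v⟫_ℂ)⁻¹) ρ :=
      (hcont.aestronglyMeasurable.inner h.aestronglyMeasurable).mul aestronglyMeasurable_const
    refine hm.congr (Filter.Eventually.of_forall fun t => ?_)
    exact (eq_inner_rightRegular_smul_mul_inv (c := c) hv t).symm
  refine Integrable.mono' (h.norm.div_const ‖v‖) hmeas (Filter.Eventually.of_forall fun t => ?_)
  rw [norm_smul, 𝒢.norm_rightRegular_apply μ (c t) v, mul_div_cancel_right₀ _ hnv]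

/-- For `v ≠ 0` and `c` continuous, the weighted orbit map `t ↦ a t • R(c t) v` is integrable iff the weight `a` is
(★ `AdelicGroupData.integrable_smul_rightRegular` for the converse). [cite: BorelJacquet1979, §4.6] -/
theorem integrable_iff_integrable_smul_rightRegular {T : Type*} [TopologicalSpace T] [MeasurableSpace T] [OpensMeasurableSpace T]
    [SecondCountableTopology T] (ρ : Measure T) {c : T → 𝒢.Adelic} (hc : Continuous c) {a : T → ℂ} {v : 𝒢.L2 μ} (hv : v ≠ 0) :
    Integrable a ρ ↔ Integrable (fun t => a t • 𝒢.rightRegular μ (c t) v) ρ :=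
  ⟨fun ha => AdelicGroupData.integrable_smul_rightRegular 𝒢 μ ρ hc ha v,
    integrable_of_integrable_smul_rightRegular ρ hc hv⟩

/-- **`pr_P` commutes with `v ↦ ∫ a(t) • R(c t) v dρ(t)` for a continuous parameter map `c` and ANY scalar weight `a`** — no
integrability hypothesis: if `a` is integrable this is ★ `starProjection_integral_smul_rightRegular_of_continuous`; otherwise both
Bochner integrals vanish (junk value), because for a non-zero vector the weighted orbit map is integrable iff `a` is.
[cite: Bump1997, Thm. 3.6.1 (proof, p. 342)] [cite: BorelJacquet1979, §4.6] -/
theorem starProjection_integral_smul_rightRegular' (P : DiscreteAutomorphicRep 𝒢 μ) {T : Type*} [TopologicalSpace T]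
    [MeasurableSpace T] [OpensMeasurableSpace T] [SecondCountableTopology T] (ρ : Measure T) {c : T → 𝒢.Adelic}
    (hc : Continuous c) (a : T → ℂ) (v : 𝒢.L2 μ) :
    P.space.toSubmodule.starProjection (∫ t, a t • 𝒢.rightRegular μ (c t) v ∂ρ) =
      ∫ t, a t • 𝒢.rightRegular μ (c t) (P.space.toSubmodule.starProjection v) ∂ρ := by
  by_cases ha : Integrable a ρ
  · exact P.starProjection_integral_smul_rightRegular_of_continuous ρ hc ha v
  by_cases hv : v = 0
  · subst hv
    simp only [map_zero, smul_zero, integral_zero]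
  have h1 : ¬ Integrable (fun t => a t • 𝒢.rightRegular μ (c t) v) ρ :=
    fun h => ha (integrable_of_integrable_smul_rightRegular ρ hc hv h)
  rw [integral_undef h1, map_zero]
  by_cases hpv : P.space.toSubmodule.starProjection v = 0
  · rw [hpv]
    simp only [map_zero, smul_zero, integral_zero]
  have h2 : ¬ Integrable (fun t => a t • 𝒢.rightRegular μ (c t) (P.space.toSubmodule.starProjection v)) ρ :=
    fun h => ha (integrable_of_integrable_smul_rightRegular ρ hc hpv h)
  rw [integral_undef h2]

/-- **`pr_P` commutes with a MATRIX kernel operator on pairs** `(T_A v)_j = Σ_i ∫ A(t)_{ji} • R(c t) v_i dρ(t)` (`c` continuous, any `A`):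
`pr_P ((T_A v)_j) = (T_A (pr_P ∘ v))_j`. [cite: Bump1997, Thm. 3.6.1 (proof, p. 342)] [cite: BorelJacquet1979, §4.6] -/
theorem starProjection_sum_integral_smul_rightRegular (P : DiscreteAutomorphicRep 𝒢 μ) {T : Type*} [TopologicalSpace T]
    [MeasurableSpace T] [OpensMeasurableSpace T] [SecondCountableTopology T] (ρ : Measure T) {c : T → 𝒢.Adelic}
    (hc : Continuous c) {ι : Type*} (s : Finset ι) (A : T → ι → ℂ) (v : ι → 𝒢.L2 μ) :
    P.space.toSubmodule.starProjection (∑ i ∈ s, ∫ t, A t i • 𝒢.rightRegular μ (c t) (v i) ∂ρ) =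
      ∑ i ∈ s, ∫ t, A t i • 𝒢.rightRegular μ (c t) (P.space.toSubmodule.starProjection (v i)) ∂ρ := by
  rw [map_sum]
  exact Finset.sum_congr rfl fun i _ => starProjection_integral_smul_rightRegular' P ρ hc (fun t => A t i) (v i)

/-- **Reproduced pairs stay reproduced after projection** (matrix kernels, no integrability hypothesis): if `(T_A v)_j = v_j` for all `j`
then `(T_A (pr_P ∘ v))_j = pr_P v_j`. [cite: Bump1997, Thm. 3.6.1 (proof, p. 342)] -/
theorem sum_integral_smul_rightRegular_starProjection_eq_self (P : DiscreteAutomorphicRep 𝒢 μ) {T : Type*} [TopologicalSpace T]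
    [MeasurableSpace T] [OpensMeasurableSpace T] [SecondCountableTopology T] (ρ : Measure T) {c : T → 𝒢.Adelic}
    (hc : Continuous c) {ι : Type*} (s : Finset ι) (A : T → ι → ι → ℂ) (v : ι → 𝒢.L2 μ)
    (hfix : ∀ j, ∑ i ∈ s, ∫ t, A t j i • 𝒢.rightRegular μ (c t) (v i) ∂ρ = v j) (j : ι) :
    ∑ i ∈ s, ∫ t, A t j i • 𝒢.rightRegular μ (c t) (P.space.toSubmodule.starProjection (v i)) ∂ρ =
      P.space.toSubmodule.starProjection (v j) := by
  rw [← starProjection_sum_integral_smul_rightRegular P ρ hc s (fun t i => A t j i) v, hfix j]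

/-! ### The `𝔭`-orbit map through `pr_P`: chain rule and weak Cauchy–Riemann -/

variable {ιU : Type*}

/-- The orbit map of `pr_P v` along any family of group elements is `pr_P ∘` the orbit map of `v` (★ `starProjection_rightRegular`).
[cite: BorelJacquet1979, §4.6] -/
theorem rightRegular_starProjection_comp (P : DiscreteAutomorphicRep 𝒢 μ) (g : ιU → 𝒢.Adelic) (v : 𝒢.L2 μ) :
    (fun b => 𝒢.rightRegular μ (g b) (P.space.toSubmodule.starProjection v)) =
      fun b => P.space.toSubmodule.starProjection (𝒢.rightRegular μ (g b) v) :=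
  funext fun b => (P.starProjection_rightRegular (g b) v).symm

variable {E : Type*} [NormedAddCommGroup E] [NormedSpace ℝ E]

/-- **Chain rule through `pr_P`**: if the orbit map `b ↦ R(g b) v` on a real normed space has derivative `D` at `b₀`, then the orbit map
of `pr_P v` has derivative `pr_P ∘ D` there. [cite: DeitmarEchterhoff2014, Thm. 7.3.2] -/
theorem hasFDerivAt_rightRegular_starProjection (P : DiscreteAutomorphicRep 𝒢 μ) (g : E → 𝒢.Adelic) (v : 𝒢.L2 μ) {b₀ : E}
    {D : E →L[ℝ] 𝒢.L2 μ} (hD : HasFDerivAt (fun b => 𝒢.rightRegular μ (g b) v) D b₀) :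
    HasFDerivAt (fun b => 𝒢.rightRegular μ (g b) (P.space.toSubmodule.starProjection v))
      ((P.space.toSubmodule.starProjection.restrictScalars ℝ).comp D) b₀ := by
  rw [rightRegular_starProjection_comp P g v]
  exact (P.space.toSubmodule.starProjection.restrictScalars ℝ).hasFDerivAt.comp b₀ hD

/-- The orbit map of `pr_P v` is differentiable wherever that of `v` is. [cite: DeitmarEchterhoff2014, Thm. 7.3.2] -/
theorem differentiableAt_rightRegular_starProjection (P : DiscreteAutomorphicRep 𝒢 μ) (g : E → 𝒢.Adelic) (v : 𝒢.L2 μ) {b₀ : E}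
    (hd : DifferentiableAt ℝ (fun b => 𝒢.rightRegular μ (g b) v) b₀) :
    DifferentiableAt ℝ (fun b => 𝒢.rightRegular μ (g b) (P.space.toSubmodule.starProjection v)) b₀ :=
  (hasFDerivAt_rightRegular_starProjection P g v hd.hasFDerivAt).differentiableAt

/-- The Fréchet derivative of the orbit map of `pr_P v` is `pr_P ∘` that of `v` (where the latter is differentiable).
[cite: DeitmarEchterhoff2014, Thm. 7.3.2] -/
theorem fderiv_rightRegular_starProjection_apply (P : DiscreteAutomorphicRep 𝒢 μ) (g : E → 𝒢.Adelic) (v : 𝒢.L2 μ) {b₀ : E}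
    (hd : DifferentiableAt ℝ (fun b => 𝒢.rightRegular μ (g b) v) b₀) (b : E) :
    fderiv ℝ (fun b => 𝒢.rightRegular μ (g b) (P.space.toSubmodule.starProjection v)) b₀ b =
      P.space.toSubmodule.starProjection (fderiv ℝ (fun b => 𝒢.rightRegular μ (g b) v) b₀ b) := by
  rw [(hasFDerivAt_rightRegular_starProjection P g v hd.hasFDerivAt).fderiv]
  rfl

end Generic

/-! ### Weak Cauchy–Riemann through `pr_P` (domain `ℂ²`, real differentials) -/

section WeakCR

universe u

variable {K : Type} [Field K] [NumberField K] {𝒢 : AdelicGroupData.{u} K} {μ : Measure 𝒢.automorphicQuotient}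
  [𝒢.IsAutomorphicMeasure μ]

/-- **Weak Cauchy–Riemann passes through `pr_P`**: if the real differential at `b₀` of `b ↦ R(g b) v` (`b ∈ ℂ²`) is `ℂ`-linear, so is that
of `b ↦ R(g b) (pr_P v)` (it is `pr_P ∘ D`, and `pr_P` is `ℂ`-linear). [cite: BorelWallach2000, VII 2.10] [cite: BorelJacquet1979, §4.6] -/
theorem fderiv_rightRegular_starProjection_I_smul (P : DiscreteAutomorphicRep 𝒢 μ) (g : (Fin 2 → ℂ) → 𝒢.Adelic) (v : 𝒢.L2 μ)
    {b₀ : Fin 2 → ℂ} (hd : DifferentiableAt ℝ (fun b => 𝒢.rightRegular μ (g b) v) b₀)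
    (hCR : ∀ b : Fin 2 → ℂ, fderiv ℝ (fun b => 𝒢.rightRegular μ (g b) v) b₀ (Complex.I • b) =
      Complex.I • fderiv ℝ (fun b => 𝒢.rightRegular μ (g b) v) b₀ b) (b : Fin 2 → ℂ) :
    fderiv ℝ (fun b => 𝒢.rightRegular μ (g b) (P.space.toSubmodule.starProjection v)) b₀ (Complex.I • b) =
      Complex.I • fderiv ℝ (fun b => 𝒢.rightRegular μ (g b) (P.space.toSubmodule.starProjection v)) b₀ b := by
  rw [fderiv_rightRegular_starProjection_apply P g v hd, fderiv_rightRegular_starProjection_apply P g v hd, hCR b, map_smul]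

end WeakCR

/-! ## §2 The closer: stub (H) of `Lines/F0_P2SpectralProjectionD.lean`, body unfolded verbatim -/

/-- **(H) `pr_P` transports the `L²`-level cotangent data** — the registered stub `stub_H_projectedL2Data : StubHProjectedL2Data` of
`Cruxes/H413/Lines/F0_P2SpectralProjectionD.lean` (v1.1 e1fa5bd1360092b6), body VERBATIM with the Lines-local bundles unfolded
(`G3 L H` ↦ `adelicGroupData L⁺ L c̄ 3 H`; `kernelOp`, `orbitP`, `IsWeaklyHol` ↦ their bodies; the `Prop`-structure `IsL2CotPair … u` ↦ its
six fields `repro ∕ kc ∕ kf ∕ ktype ∕ diffOrbit ∕ weakHol` in order, as hypotheses for `u` and as a conjunction for `j ↦ pr_P (u j)`).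
For every discrete automorphic `P` the projected pair is again reproduced by `A` (`pr_P ∘ T_A = T_A ∘ pr_P`, §1, no regularity of `A`
needed), `K_c`- and `K_f`-invariant, of cotangent `K_∞`-type `weightOf x₀`, with differentiable `𝔭`-orbit maps satisfying weak
Cauchy–Riemann. [cite: BorelJacquet1979, §4.6] [cite: Bump1997, Thm. 3.6.1 (proof, p. 342)] [cite: DeitmarEchterhoff2014, Thm. 7.3.2] -/
theorem stubHProjectedL2Data_holds :
    ∀ (L : Type) [Field L] [NumberField L] [IsCMField L] (ι : L →+* ℂ) (H : Matrix (Fin 3) (Fin 3) L) (T : GL (Fin 3) ℂ)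
    (hT : (T : Matrix (Fin 3) (Fin 3) ℂ)ᴴ * H.map ι * (T : Matrix (Fin 3) (Fin 3) ℂ) = Literature.Geometry.ComplexHyperbolic.BallModel.J)
    (μ : Measure (adelicGroupData (↥(maximalRealSubfield L)) L (IsCMField.complexConj L) 3 H).automorphicQuotient)
    [(adelicGroupData (↥(maximalRealSubfield L)) L (IsCMField.complexConj L) 3 H).IsAutomorphicMeasure μ]
    (ν : Measure U21) [ν.IsHaarMeasure] (A : U21 → Matrix (Fin 2) (Fin 2) ℂ)
    (P : DiscreteAutomorphicRep (adelicGroupData (↥(maximalRealSubfield L)) L (IsCMField.complexConj L) 3 H) μ)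
    (u : Fin 2 → (adelicGroupData (↥(maximalRealSubfield L)) L (IsCMField.complexConj L) 3 H).L2 μ),
    -- `IsL2CotPair L ι H T hT μ ν A u`, field by field
    (∀ j, (∑ i : Fin 2, ∫ t, A t j i •
        (adelicGroupData (↥(maximalRealSubfield L)) L (IsCMField.complexConj L) 3 H).rightRegular μ
          (cmArchSection L ι H T hT t) (u i) ∂ν) = u j) →
    (∀ k ∈ cmCompactFactor L ι H T hT, ∀ j,
      (adelicGroupData (↥(maximalRealSubfield L)) L (IsCMField.complexConj L) 3 H).rightRegular μ k (u j) = u j) →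
    (∃ Kf : Subgroup (finAdelic (↥(maximalRealSubfield L)) L (IsCMField.complexConj L) 3 H),
      IsOpen (Kf : Set (finAdelic (↥(maximalRealSubfield L)) L (IsCMField.complexConj L) 3 H)) ∧
        ∀ k ∈ Kf, ∀ j, (adelicGroupData (↥(maximalRealSubfield L)) L (IsCMField.complexConj L) 3 H).rightRegular μ
          (finAdelicToAdelic (↥(maximalRealSubfield L)) L (IsCMField.complexConj L) 3 H k) (u j) = u j) →
    (∀ (k : stabilizer (↥U21) x₀) (j : Fin 2),
      (adelicGroupData (↥(maximalRealSubfield L)) L (IsCMField.complexConj L) 3 H).rightRegular μ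
          (cmArchSection L ι H T hT k) (u j) =
        ∑ i : Fin 2, (BallForms.isPullbackCocycle_cotangentCocycle.weightOf x₀ k⁻¹ (Pi.single i 1)) j • u i) →
    (∀ j, DifferentiableAt ℝ
      (fun b : Fin 2 → ℂ => (adelicGroupData (↥(maximalRealSubfield L)) L (IsCMField.complexConj L) 3 H).rightRegular μ
        (cmArchSection L ι H T hT (BallForms.expP b)) (u j)) 0) →
    (∀ j, ∀ b : Fin 2 → ℂ,
      fderiv ℝ (fun b : Fin 2 → ℂ => (adelicGroupData (↥(maximalRealSubfield L)) L (IsCMField.complexConj L) 3 H).rightRegular μ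
          (cmArchSection L ι H T hT (BallForms.expP b)) (u j)) 0 (Complex.I • b) =
        Complex.I • fderiv ℝ (fun b : Fin 2 → ℂ =>
          (adelicGroupData (↥(maximalRealSubfield L)) L (IsCMField.complexConj L) 3 H).rightRegular μ
            (cmArchSection L ι H T hT (BallForms.expP b)) (u j)) 0 b) →
    -- `IsL2CotPair L ι H T hT μ ν A (fun j => pr_P (u j))`, field by field
    (∀ j, (∑ i : Fin 2, ∫ t, A t j i •
        (adelicGroupData (↥(maximalRealSubfield L)) L (IsCMField.complexConj L) 3 H).rightRegular μ
          (cmArchSection L ι H T hT t) (P.space.toSubmodule.starProjection (u i)) ∂ν) =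
        P.space.toSubmodule.starProjection (u j)) ∧
    (∀ k ∈ cmCompactFactor L ι H T hT, ∀ j,
      (adelicGroupData (↥(maximalRealSubfield L)) L (IsCMField.complexConj L) 3 H).rightRegular μ k
        (P.space.toSubmodule.starProjection (u j)) = P.space.toSubmodule.starProjection (u j)) ∧
    (∃ Kf : Subgroup (finAdelic (↥(maximalRealSubfield L)) L (IsCMField.complexConj L) 3 H),
      IsOpen (Kf : Set (finAdelic (↥(maximalRealSubfield L)) L (IsCMField.complexConj L) 3 H)) ∧
        ∀ k ∈ Kf, ∀ j, (adelicGroupData (↥(maximalRealSubfield L)) L (IsCMField.complexConj L) 3 H).rightRegular μ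
          (finAdelicToAdelic (↥(maximalRealSubfield L)) L (IsCMField.complexConj L) 3 H k)
            (P.space.toSubmodule.starProjection (u j)) = P.space.toSubmodule.starProjection (u j)) ∧
    (∀ (k : stabilizer (↥U21) x₀) (j : Fin 2),
      (adelicGroupData (↥(maximalRealSubfield L)) L (IsCMField.complexConj L) 3 H).rightRegular μ
          (cmArchSection L ι H T hT k) (P.space.toSubmodule.starProjection (u j)) =
        ∑ i : Fin 2, (BallForms.isPullbackCocycle_cotangentCocycle.weightOf x₀ k⁻¹ (Pi.single i 1)) j •
          P.space.toSubmodule.starProjection (u i)) ∧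
    (∀ j, DifferentiableAt ℝ
      (fun b : Fin 2 → ℂ => (adelicGroupData (↥(maximalRealSubfield L)) L (IsCMField.complexConj L) 3 H).rightRegular μ
        (cmArchSection L ι H T hT (BallForms.expP b)) (P.space.toSubmodule.starProjection (u j))) 0) ∧
    (∀ j, ∀ b : Fin 2 → ℂ,
      fderiv ℝ (fun b : Fin 2 → ℂ => (adelicGroupData (↥(maximalRealSubfield L)) L (IsCMField.complexConj L) 3 H).rightRegular μ
          (cmArchSection L ι H T hT (BallForms.expP b)) (P.space.toSubmodule.starProjection (u j))) 0 (Complex.I • b) =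
        Complex.I • fderiv ℝ (fun b : Fin 2 → ℂ =>
          (adelicGroupData (↥(maximalRealSubfield L)) L (IsCMField.complexConj L) 3 H).rightRegular μ
            (cmArchSection L ι H T hT (BallForms.expP b)) (P.space.toSubmodule.starProjection (u j))) 0 b) := by
  intro L _ _ _ ι H T hT μ _ ν _ A P u hrepro hkc hkf hktype hdiff hweak
  have hc : Continuous (cmArchSection L ι H T hT) := continuous_archSectionU21CM L ι H T hT
  refine ⟨fun j => ?_, fun k hk j => ?_, ?_, fun k j => ?_, fun j => ?_, fun j b => ?_⟩
  · -- repro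
    exact sum_integral_smul_rightRegular_starProjection_eq_self P ν hc Finset.univ (fun t j i => A t j i) u hrepro j
  · -- kc
    exact P.rightRegular_starProjection_of_forall (cmCompactFactor L ι H T hT) (fun k' hk' => hkc k' hk' j) hk
  · -- kf
    obtain ⟨Kf, hKo, hKf⟩ := hkf
    refine ⟨Kf, hKo, fun k hk j => ?_⟩
    rw [← P.starProjection_rightRegular, hKf k hk j]
  · -- ktype
    exact P.rightRegular_starProjection_eq_sum Finset.univ
      (c := fun j i => (BallForms.isPullbackCocycle_cotangentCocycle.weightOf x₀ k⁻¹ (Pi.single i 1)) j)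
      (fun j' => hktype k j') j
  · -- diffOrbit
    exact differentiableAt_rightRegular_starProjection P (fun b => cmArchSection L ι H T hT (BallForms.expP b)) (u j) (hdiff j)
  · -- weakHol
    exact fderiv_rightRegular_starProjection_I_smul P (fun b => cmArchSection L ι H T hT (BallForms.expP b)) (u j) (hdiff j)
      (hweak j) b

end Summit.HodgeConjecture.HodgeConjecture.Cruxes.H413.F0P2dStubHProjectedL2Data

end
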